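import Summits.HodgeConjecture.HodgeCM.Model.ArchKTypeOfDistHol_1

/-! PORT of `HodgeCM/Model/ArchKTypeOfDistHol.lean` (HodgeCMPerL run 82) — part 2: continuation of `Summits.HodgeConjecture.HodgeCM.Model.ArchKTypeOfDistHol_1` (split at a top-level declaration boundary by port_pkg.py; scope re-opened below; declarations unchanged). -/

-- port_pkg: scope re-opened for this part (file-level context, then the namespace/section stack open at the cut)
set_option autoImplicit false
noncomputable section
open Filter Topology Complex
open NumberField NumberField.InfinitePlace NumberField.mixedEmbedding IsDedekindDomain MeasureTheory
open scoped Matrix TensorProduct Classical SchwartzMap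
open MulAction
open Literature.Geometry.ComplexHyperbolic.BallModel (U21 x₀ stabilizerEquivK21)
open Literature.NumberTheory.Automorphic.U21 (K21 matA sclD pPlus pPlus_apply)
open Literature.AlgebraicGeometry.HodgeTheory
open Literature.AlgebraicGeometry.ShimuraVarieties Literature.AlgebraicGeometry.ShimuraVarieties.BallForms
open Literature.NumberTheory.Automorphic Literature.NumberTheory.Weil1964
open Literature.RepresentationTheory.HeisenbergGroup (polar Heisenberg symplecticGroup ofSymplectic)
open Literature.RepresentationTheory.KonnoKonno2007 Literature.RepresentationTheory.KonnoKonno2007.RealDualPair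
open Literature.NumberTheory.GelbartRogawski1991 Literature.NumberTheory.GelbartRogawski1991.UnitaryDualPair
open Literature.Analysis.SegalBargmann Literature.Analysis.Distribution
open Literature.NumberTheory.Automorphic.PicardCM
open HodgeCM.Adelic HodgeCM.PerL34 HodgeCM.Model.HypCensus HodgeCM.Model.SupplyInstance HodgeCM.Model.ArchSideTerm
namespace HodgeCM.Model
section Slots
variable {L : CMField} {ι₁ : L →+* ℂ} (V : HermSpace3 L ι₁) (c : SeesawCtx L)
variable
  (hGR : (cmSplittingDatum (L : Type) finProdFinEquiv (frameD V) (frameD_real V) (frameD_ne V) (dW c.D) (dW_real c.D)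
    (dW_ne c.D)).CompatibleSplitting)
  (hGR₀ : (cmSplittingDatum (L : Type) (e₁) (frameD V) (frameD_real V) (frameD_ne V) (lineVec (L : Type) (dW c.D 0))
    (fun _ => dW_real c.D 0) (fun _ => dW_ne c.D 0)).CompatibleSplitting)
  (hGR₁ : (cmSplittingDatum (L : Type) (e₁) (frameD V) (frameD_real V) (frameD_ne V) (lineVec (L : Type) (dW c.D 1))
    (fun _ => dW_real c.D 1) (fun _ => dW_ne c.D 1)).CompatibleSplitting)
  (η₀ η₁ : CMAdelic (L : Type) (frameD V) × CMAdelicOne (L : Type) →* ℂˣ)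
  (h₁W : (∀ j, 0 < (ι₁ (dW c.D j)).re) ∨ ∀ j, (ι₁ (dW c.D j)).re < 0)
  (Φ₂ : SchwartzMap ((Fin 3 × {v : {v : InfinitePlace ↥(maximalRealSubfield L) // v.IsReal} // v ≠ HypCensus.cmPlace (L : Type) ι₁}) → ℝ) ℂ)
section One
variable
  (eR : PosIdx (cmXW (L : Type) (frameD V) (lineVec (L : Type) (dW c.D 1)) (fun _ => dW_real c.D 1) ι₁ (HypCensus.cmPlace (L : Type) ι₁)) ≃ Unit)
  (eS : NegIdx (cmXW (L : Type) (frameD V) (lineVec (L : Type) (dW c.D 1)) (fun _ => dW_real c.D 1) ι₁ (HypCensus.cmPlace (L : Type) ι₁)) ≃ Empty)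
/-- the intertwining `hτ` of the AN/REP bricks for `lineOmega_one` along `twistU21 ∘ expP`, `τ := F⁻¹` (record-free form of #CA14
`archKTypeOfSlotOne_hτG`). -/
theorem lineOmega_one_twistU21_expP_symm_applyG (b : Fin 2 → ℂ)
    (x : SchwartzMap (DPIdx (Fin 2) Unit Unit Empty ⊕
      (Fin 3 × {w : {w : InfinitePlace ↥(maximalRealSubfield L) // w.IsReal} // w ≠ HypCensus.cmPlace (L : Type) ι₁}) → ℝ) ℂ) :
    lineOmega_one V c.D hGR hGR₀ hGR₁ η₁ (twistU21 L ι₁ (BallForms.expP b))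
        (((cmBlockFrameAt (L : Type) e₁ (frameD V) (frameD_real V) (frameD_ne V) (lineVec (L : Type) (dW c.D 1))
          (fun _ => dW_real c.D 1) (fun _ => dW_ne c.D 1) ι₁ (HypCensus.cmPlace (L : Type) ι₁) (blockPosEquiv V) (blockNegEquiv V) eR eS).symm :
            _ ≃L[ℂ] _) x) =
      ((cmBlockFrameAt (L : Type) e₁ (frameD V) (frameD_real V) (frameD_ne V) (lineVec (L : Type) (dW c.D 1))
          (fun _ => dW_real c.D 1) (fun _ => dW_ne c.D 1) ι₁ (HypCensus.cmPlace (L : Type) ι₁) (blockPosEquiv V) (blockNegEquiv V) eR eS).symm :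
            _ ≃L[ℂ] _)
        (cmBlockRepAt (L : Type) e₁ (frameD V) (frameD_real V) (frameD_ne V) (lineVec (L : Type) (dW c.D 1)) (fun _ => dW_real c.D 1)
          (fun _ => dW_ne c.D 1) hGR₁ ι₁ (HypCensus.cmPlace (L : Type) ι₁) (blockPosEquiv V) (blockNegEquiv V) eR eS
          (cmBlockSectionAt (L : Type) (frameD V) (frameD_real V) (frameD_ne V) (lineVec (L : Type) (dW c.D 1))
            (fun _ => dW_real c.D 1) (fun _ => dW_ne c.D 1) ι₁ (HypCensus.cmPlace (L : Type) ι₁) (blockPosEquiv V) (blockNegEquiv V) eR eS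
            (((u21FrameEquiv (BallForms.expP b) : UForm (Fin 2) Unit), (1 : UForm Unit Empty)) : Ginf (Fin 2) Unit Unit Empty)) x) := by
  rw [lineOmega_one_twistU21_expP_AtG, cmArchWeilRep_cmBlockFrameAt_symm]

set_option backward.isDefEq.respectTransparency false in
include h₁W in
/-- **(AN) for line 1 along `twistU21 ∘ expP`, record-free** (#CA14 `isWeaklyPDiff_archKTypeOfSlotOneG` minus the record). -/
theorem differentiableAt_lineOmega_one_twistU21_expPG
    (T : 𝓢((Fin 3 → mixedSpace (↥(maximalRealSubfield L))), ℂ) →L[ℂ] ℂ) (ℓ : Module.Dual ℂ (Fin 2 → ℂ)) :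
    DifferentiableAt ℝ (fun b => T (lineOmega_one V c.D hGR hGR₀ hGR₁ η₁ (twistU21 L ι₁ (BallForms.expP b))
      (blockFamilyOfAt (L : Type) e₁ (frameD V) (frameD_real V) (frameD_ne V) (lineVec (L : Type) (dW c.D 1)) (fun _ => dW_real c.D 1)
        (fun _ => dW_ne c.D 1) ι₁ (blockPosEquiv V) (blockNegEquiv V) eR eS (degOnePDual Empty) Φ₂ ℓ))) 0 := by
  obtain ⟨ω₁, hW₁, hc₁⟩ := exists_isArchWeilDatum_lineSlot (R := Unit) (S := Empty)
  obtain ⟨ev₁, hvac₁⟩ := (junction (Fin 2) Unit Unit Empty).exists_vacExponents hW₁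
  exact ArchPair.differentiableAt_of_blockPair
    (fun b => lineOmega_one V c.D hGR hGR₀ hGR₁ η₁ (twistU21 L ι₁ (BallForms.expP b)))
    (blockFamilyOfAt (L : Type) e₁ (frameD V) (frameD_real V) (frameD_ne V) (lineVec (L : Type) (dW c.D 1)) (fun _ => dW_real c.D 1)
      (fun _ => dW_ne c.D 1) ι₁ (blockPosEquiv V) (blockNegEquiv V) eR eS (degOnePDual Empty) Φ₂)
    (isArchWeilDatum_cmBlockAt (L : Type) e₁ (frameD V) (frameD_real V) (frameD_ne V) (lineVec (L : Type) (dW c.D 1))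
      (fun _ => dW_real c.D 1) (fun _ => dW_ne c.D 1) hGR₁ ι₁ (HypCensus.cmPlace (L : Type) ι₁) (blockPosEquiv V) (blockNegEquiv V) eR eS
      (frameD_sign_ι₁' V) (line_hs₁W h₁W 1) (frameD_sign_of_ne V) (fun τ hτ => line_hsW (dW c.D 1) τ hτ))
    (continuous_cmBlockRepAt (L : Type) e₁ (frameD V) (frameD_real V) (frameD_ne V) (lineVec (L : Type) (dW c.D 1))
      (fun _ => dW_real c.D 1) (fun _ => dW_ne c.D 1) hGR₁ ι₁ (HypCensus.cmPlace (L : Type) ι₁) (blockPosEquiv V) (blockNegEquiv V) eR eS)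
    hW₁ hc₁ hvac₁
    (cmBlockSectionAt (L : Type) (frameD V) (frameD_real V) (frameD_ne V) (lineVec (L : Type) (dW c.D 1)) (fun _ => dW_real c.D 1)
      (fun _ => dW_ne c.D 1) ι₁ (HypCensus.cmPlace (L : Type) ι₁) (blockPosEquiv V) (blockNegEquiv V) eR eS)
    (continuous_cmBlockSectionAt (L : Type) (frameD V) (frameD_real V) (frameD_ne V) (lineVec (L : Type) (dW c.D 1))
      (fun _ => dW_real c.D 1) (fun _ => dW_ne c.D 1) ι₁ (HypCensus.cmPlace (L : Type) ι₁) (blockPosEquiv V) (blockNegEquiv V) eR eS)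
    (coe_cmBlockPhaseHomAt_cmBlockSectionAt (L : Type) e₁ (frameD V) (frameD_real V) (frameD_ne V) (lineVec (L : Type) (dW c.D 1))
      (fun _ => dW_real c.D 1) (fun _ => dW_ne c.D 1) ι₁ (HypCensus.cmPlace (L : Type) ι₁) (blockPosEquiv V) (blockNegEquiv V) eR eS)
    ((cmBlockFrameAt (L : Type) e₁ (frameD V) (frameD_real V) (frameD_ne V) (lineVec (L : Type) (dW c.D 1)) (fun _ => dW_real c.D 1)
      (fun _ => dW_ne c.D 1) ι₁ (HypCensus.cmPlace (L : Type) ι₁) (blockPosEquiv V) (blockNegEquiv V) eR eS).symm.toContinuousLinearMap)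
    (lineOmega_one_twistU21_expP_symm_applyG V c hGR hGR₀ hGR₁ η₁ eR eS)
    Φ₂ (degOnePDual Empty) (fun _ => rfl) T ℓ

set_option backward.isDefEq.respectTransparency false in
include h₁W in
/-- **(REP) for line 1 along `twistU21 ∘ expP` and `-i e_p`, record-free** (#CA14 `isPMinusKilledAlong_archKTypeOfSlotOne_twistG` minus the
record). -/
theorem pMinus_lineOmega_one_twistU21_expPG (p : Fin 2) (ℓ : Module.Dual ℂ (Fin 2 → ℂ)) :
    ∃ D Dᵢ : 𝓢((Fin 3 → mixedSpace (↥(maximalRealSubfield L))), ℂ),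
      Tendsto (fun t : ℝ => t⁻¹ • (lineOmega_one V c.D hGR hGR₀ hGR₁ η₁
          (twistU21 L ι₁ (BallForms.expP (t • (-Complex.I • (Pi.single p 1 : Fin 2 → ℂ)))))
          (blockFamilyOfAt (L : Type) e₁ (frameD V) (frameD_real V) (frameD_ne V) (lineVec (L : Type) (dW c.D 1)) (fun _ => dW_real c.D 1)
            (fun _ => dW_ne c.D 1) ι₁ (blockPosEquiv V) (blockNegEquiv V) eR eS (degOnePDual Empty) Φ₂ ℓ) -
          blockFamilyOfAt (L : Type) e₁ (frameD V) (frameD_real V) (frameD_ne V) (lineVec (L : Type) (dW c.D 1)) (fun _ => dW_real c.D 1)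
            (fun _ => dW_ne c.D 1) ι₁ (blockPosEquiv V) (blockNegEquiv V) eR eS (degOnePDual Empty) Φ₂ ℓ)) (𝓝[≠] 0) (𝓝 D) ∧
      Tendsto (fun t : ℝ => t⁻¹ • (lineOmega_one V c.D hGR hGR₀ hGR₁ η₁
          (twistU21 L ι₁ (BallForms.expP (t • (Complex.I • (-Complex.I • (Pi.single p 1 : Fin 2 → ℂ))))))
          (blockFamilyOfAt (L : Type) e₁ (frameD V) (frameD_real V) (frameD_ne V) (lineVec (L : Type) (dW c.D 1)) (fun _ => dW_real c.D 1)
            (fun _ => dW_ne c.D 1) ι₁ (blockPosEquiv V) (blockNegEquiv V) eR eS (degOnePDual Empty) Φ₂ ℓ) -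
          blockFamilyOfAt (L : Type) e₁ (frameD V) (frameD_real V) (frameD_ne V) (lineVec (L : Type) (dW c.D 1)) (fun _ => dW_real c.D 1)
            (fun _ => dW_ne c.D 1) ι₁ (blockPosEquiv V) (blockNegEquiv V) eR eS (degOnePDual Empty) Φ₂ ℓ)) (𝓝[≠] 0) (𝓝 Dᵢ) ∧
      D + Complex.I • Dᵢ = 0 := by
  obtain ⟨ω₁, hW₁, hc₁⟩ := exists_isArchWeilDatum_lineSlot (R := Unit) (S := Empty)
  exact ArchPair.pMinus_of_blockPair
    (fun b => lineOmega_one V c.D hGR hGR₀ hGR₁ η₁ (twistU21 L ι₁ (BallForms.expP b)))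
    (blockFamilyOfAt (L : Type) e₁ (frameD V) (frameD_real V) (frameD_ne V) (lineVec (L : Type) (dW c.D 1)) (fun _ => dW_real c.D 1)
      (fun _ => dW_ne c.D 1) ι₁ (blockPosEquiv V) (blockNegEquiv V) eR eS (degOnePDual Empty) Φ₂)
    (isArchWeilDatum_cmBlockAt (L : Type) e₁ (frameD V) (frameD_real V) (frameD_ne V) (lineVec (L : Type) (dW c.D 1))
      (fun _ => dW_real c.D 1) (fun _ => dW_ne c.D 1) hGR₁ ι₁ (HypCensus.cmPlace (L : Type) ι₁) (blockPosEquiv V) (blockNegEquiv V) eR eS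
      (frameD_sign_ι₁' V) (line_hs₁W h₁W 1) (frameD_sign_of_ne V) (fun τ hτ => line_hsW (dW c.D 1) τ hτ))
    (continuous_cmBlockRepAt (L : Type) e₁ (frameD V) (frameD_real V) (frameD_ne V) (lineVec (L : Type) (dW c.D 1))
      (fun _ => dW_real c.D 1) (fun _ => dW_ne c.D 1) hGR₁ ι₁ (HypCensus.cmPlace (L : Type) ι₁) (blockPosEquiv V) (blockNegEquiv V) eR eS)
    hW₁ hc₁
    (cmBlockSectionAt (L : Type) (frameD V) (frameD_real V) (frameD_ne V) (lineVec (L : Type) (dW c.D 1)) (fun _ => dW_real c.D 1)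
      (fun _ => dW_ne c.D 1) ι₁ (HypCensus.cmPlace (L : Type) ι₁) (blockPosEquiv V) (blockNegEquiv V) eR eS)
    (continuous_cmBlockSectionAt (L : Type) (frameD V) (frameD_real V) (frameD_ne V) (lineVec (L : Type) (dW c.D 1))
      (fun _ => dW_real c.D 1) (fun _ => dW_ne c.D 1) ι₁ (HypCensus.cmPlace (L : Type) ι₁) (blockPosEquiv V) (blockNegEquiv V) eR eS)
    (coe_cmBlockPhaseHomAt_cmBlockSectionAt (L : Type) e₁ (frameD V) (frameD_real V) (frameD_ne V) (lineVec (L : Type) (dW c.D 1))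
      (fun _ => dW_real c.D 1) (fun _ => dW_ne c.D 1) ι₁ (HypCensus.cmPlace (L : Type) ι₁) (blockPosEquiv V) (blockNegEquiv V) eR eS)
    ((cmBlockFrameAt (L : Type) e₁ (frameD V) (frameD_real V) (frameD_ne V) (lineVec (L : Type) (dW c.D 1)) (fun _ => dW_real c.D 1)
      (fun _ => dW_ne c.D 1) ι₁ (HypCensus.cmPlace (L : Type) ι₁) (blockPosEquiv V) (blockNegEquiv V) eR eS).symm.toContinuousLinearMap)
    (lineOmega_one_twistU21_expP_symm_applyG V c hGR hGR₀ hGR₁ η₁ eR eS)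
    Φ₂ (degOnePDual Empty) (fun _ => rfl) (hypOpGen_add_I_smul_rotBoostGen_degOnePDual Empty) p ℓ

/-! ##### § 3 (line 1): at `expP` with the canonical representative — (a4) `hd`, the `𝔭₋`-limits, (a5) `hCR` -/

include h₁W in
/-- **(a4) for line 1 — `hd` of sinst-1's #1251, record-free**: `b ↦ T (lineOmega_zero … (expP b) (Φ_∞,1(ℓ)))` is real-differentiable at `0`
(canonical representative `hemb`: `twistU21 = id`). -/
theorem hd_lineOmega_oneG (hemb : (InfinitePlace.mk ι₁).embedding = ι₁)
    (T : 𝓢((Fin 3 → mixedSpace (↥(maximalRealSubfield L))), ℂ) →L[ℂ] ℂ) (ℓ : Module.Dual ℂ (Fin 2 → ℂ)) :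
    DifferentiableAt ℝ (fun b => T (lineOmega_one V c.D hGR hGR₀ hGR₁ η₁ (BallForms.expP b)
      (blockFamilyOfAt (L : Type) e₁ (frameD V) (frameD_real V) (frameD_ne V) (lineVec (L : Type) (dW c.D 1)) (fun _ => dW_real c.D 1)
        (fun _ => dW_ne c.D 1) ι₁ (blockPosEquiv V) (blockNegEquiv V) eR eS (degOnePDual Empty) Φ₂ ℓ))) 0 := by
  have h := differentiableAt_lineOmega_one_twistU21_expPG V c hGR hGR₀ hGR₁ η₁ h₁W Φ₂ eR eS T ℓ
  simp only [twistU21_eq_self_of_embedding_eq hemb] at h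
  exact h

include h₁W in
/-- the `𝔭₋`-limits of line 1 at `expP` along `-i e_p` (row 15 `hk` in the END-STATE shape, record-free). -/
theorem pMinus_lineOmega_oneG (hemb : (InfinitePlace.mk ι₁).embedding = ι₁) (p : Fin 2) (ℓ : Module.Dual ℂ (Fin 2 → ℂ)) :
    ∃ D Dᵢ : 𝓢((Fin 3 → mixedSpace (↥(maximalRealSubfield L))), ℂ),
      Tendsto (fun t : ℝ => t⁻¹ • (lineOmega_one V c.D hGR hGR₀ hGR₁ η₁
          (BallForms.expP (t • (-Complex.I • (Pi.single p 1 : Fin 2 → ℂ))))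
          (blockFamilyOfAt (L : Type) e₁ (frameD V) (frameD_real V) (frameD_ne V) (lineVec (L : Type) (dW c.D 1)) (fun _ => dW_real c.D 1)
            (fun _ => dW_ne c.D 1) ι₁ (blockPosEquiv V) (blockNegEquiv V) eR eS (degOnePDual Empty) Φ₂ ℓ) -
          blockFamilyOfAt (L : Type) e₁ (frameD V) (frameD_real V) (frameD_ne V) (lineVec (L : Type) (dW c.D 1)) (fun _ => dW_real c.D 1)
            (fun _ => dW_ne c.D 1) ι₁ (blockPosEquiv V) (blockNegEquiv V) eR eS (degOnePDual Empty) Φ₂ ℓ)) (𝓝[≠] 0) (𝓝 D) ∧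
      Tendsto (fun t : ℝ => t⁻¹ • (lineOmega_one V c.D hGR hGR₀ hGR₁ η₁
          (BallForms.expP (t • (Complex.I • (-Complex.I • (Pi.single p 1 : Fin 2 → ℂ)))))
          (blockFamilyOfAt (L : Type) e₁ (frameD V) (frameD_real V) (frameD_ne V) (lineVec (L : Type) (dW c.D 1)) (fun _ => dW_real c.D 1)
            (fun _ => dW_ne c.D 1) ι₁ (blockPosEquiv V) (blockNegEquiv V) eR eS (degOnePDual Empty) Φ₂ ℓ) -
          blockFamilyOfAt (L : Type) e₁ (frameD V) (frameD_real V) (frameD_ne V) (lineVec (L : Type) (dW c.D 1)) (fun _ => dW_real c.D 1)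
            (fun _ => dW_ne c.D 1) ι₁ (blockPosEquiv V) (blockNegEquiv V) eR eS (degOnePDual Empty) Φ₂ ℓ)) (𝓝[≠] 0) (𝓝 Dᵢ) ∧
      D + Complex.I • Dᵢ = 0 := by
  have h := pMinus_lineOmega_one_twistU21_expPG V c hGR hGR₀ hGR₁ η₁ h₁W Φ₂ eR eS p ℓ
  simp only [twistU21_eq_self_of_embedding_eq hemb] at h
  exact h

include h₁W in
/-- **(a5) for line 1 — `hCR` of sinst-1's #1251, record-free**: the scalarised differential at `0` of
`b ↦ T (lineOmega_zero … (expP b) (Φ_∞,1(ℓ)))` is complex-linear (record-free twin of `ThetaHolDirections.isWeaklyCR_of_isPMinusKilledAlong`,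
`c p := -i`). -/
theorem hCR_lineOmega_oneG (hemb : (InfinitePlace.mk ι₁).embedding = ι₁)
    (T : 𝓢((Fin 3 → mixedSpace (↥(maximalRealSubfield L))), ℂ) →L[ℂ] ℂ) (ℓ : Module.Dual ℂ (Fin 2 → ℂ)) (v : Fin 2 → ℂ) :
    fderiv ℝ (fun b => T (lineOmega_one V c.D hGR hGR₀ hGR₁ η₁ (BallForms.expP b)
        (blockFamilyOfAt (L : Type) e₁ (frameD V) (frameD_real V) (frameD_ne V) (lineVec (L : Type) (dW c.D 1)) (fun _ => dW_real c.D 1)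
          (fun _ => dW_ne c.D 1) ι₁ (blockPosEquiv V) (blockNegEquiv V) eR eS (degOnePDual Empty) Φ₂ ℓ))) 0 (Complex.I • v) =
      Complex.I • fderiv ℝ (fun b => T (lineOmega_one V c.D hGR hGR₀ hGR₁ η₁ (BallForms.expP b)
        (blockFamilyOfAt (L : Type) e₁ (frameD V) (frameD_real V) (frameD_ne V) (lineVec (L : Type) (dW c.D 1)) (fun _ => dW_real c.D 1)
          (fun _ => dW_ne c.D 1) ι₁ (blockPosEquiv V) (blockNegEquiv V) eR eS (degOnePDual Empty) Φ₂ ℓ))) 0 v := by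
  have h0 : lineOmega_one V c.D hGR hGR₀ hGR₁ η₁ (BallForms.expP 0)
      (blockFamilyOfAt (L : Type) e₁ (frameD V) (frameD_real V) (frameD_ne V) (lineVec (L : Type) (dW c.D 1)) (fun _ => dW_real c.D 1)
        (fun _ => dW_ne c.D 1) ι₁ (blockPosEquiv V) (blockNegEquiv V) eR eS (degOnePDual Empty) Φ₂ ℓ) =
      blockFamilyOfAt (L : Type) e₁ (frameD V) (frameD_real V) (frameD_ne V) (lineVec (L : Type) (dW c.D 1)) (fun _ => dW_real c.D 1)
        (fun _ => dW_ne c.D 1) ι₁ (blockPosEquiv V) (blockNegEquiv V) eR eS (degOnePDual Empty) Φ₂ ℓ := by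
    rw [BallForms.expP_zero, map_one, Module.End.one_apply]
  refine ThetaHolDirections.apply_I_smul_of_basis
    ((fderiv ℝ (fun b => T (lineOmega_one V c.D hGR hGR₀ hGR₁ η₁ (BallForms.expP b)
      (blockFamilyOfAt (L : Type) e₁ (frameD V) (frameD_real V) (frameD_ne V) (lineVec (L : Type) (dW c.D 1)) (fun _ => dW_real c.D 1)
        (fun _ => dW_ne c.D 1) ι₁ (blockPosEquiv V) (blockNegEquiv V) eR eS (degOnePDual Empty) Φ₂ ℓ))) 0).toLinearMap)
    (fun _ => -Complex.I) (fun _ => neg_ne_zero.2 Complex.I_ne_zero) (fun p => ?_) v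
  obtain ⟨D, Dᵢ, hD, hDᵢ, hsum⟩ := pMinus_lineOmega_oneG V c hGR hGR₀ hGR₁ η₁ h₁W Φ₂ eR eS hemb p ℓ
  exact ThetaHolAssembly.fderiv_I_smul_of_slopes T
    (Ψ := fun b => lineOmega_one V c.D hGR hGR₀ hGR₁ η₁ (BallForms.expP b)
      (blockFamilyOfAt (L : Type) e₁ (frameD V) (frameD_real V) (frameD_ne V) (lineVec (L : Type) (dW c.D 1)) (fun _ => dW_real c.D 1)
        (fun _ => dW_ne c.D 1) ι₁ (blockPosEquiv V) (blockNegEquiv V) eR eS (degOnePDual Empty) Φ₂ ℓ))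
    (hd_lineOmega_oneG V c hGR hGR₀ hGR₁ η₁ h₁W Φ₂ eR eS hemb T ℓ) _
    (by simpa only [h0] using hD) (by simpa only [h0] using hDᵢ) hsum

end One

end Slots


end HodgeCM.Model

end
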